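import Literature.MathematicalPhysics.QuantumFieldTheory.Balaban1983to89.B9Eq3126KFloorSlotDiagonal
import Literature.MathematicalPhysics.QuantumFieldTheory.Balaban1983to89.B9Eq3120DeltaPiPrimeFormDiagonalClosed
import Literature.MathematicalPhysics.QuantumFieldTheory.Balaban1983to89.B9Eq3126H1BoundTowerVariational
import Literature.MathematicalPhysics.QuantumFieldTheory.Balaban1983to89.B11Eq117TransformationNorm

/-!
# `Balaban1983to89.B9Eq3126EnergyBallTowerPiCLM` — T. Bałaban, *The variational problem and background fields in renormalization group method for
# lattice gauge theories*, Commun. Math. Phys. **102** (1985) 277–309 [Balaban1985Variational] (117) p. 295 with (103) p. 293, (110)–(111) p. 294, (115)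
# p. 294, and T. Bałaban, *Propagators for lattice gauge theories in a background field*, Commun. Math. Phys. **99** (1985) 389–434
# [Balaban1985BackgroundPropagators] (3.122) ∕ (3.126) p. 420, (3.153) p. 426, Thm 3.13 p. 426: THE (117)-ISOLATION FOR PRINT's OWN LETTERS — the `k`-level
# chart letters `H̃_{1,k}(U)`, `𝔊̃_k(U)` of print's operator (3.122) (`B9Eq3119DeltaPiTower.laplaceAkPi`, NAMED) in the type `NegSize → Space115 … (∇_U)`
# bounded on print's diagonal by a LEVEL-FREE constant TIMES (117)'s EXPLICIT finite-lattice factor, `∃ α₀ C` BEFORE EVERY BINDER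

statement-level skeleton of published theorems with citation tags; proofs where landed; nothing here is a claim about the Yang–Mills mass gap

CITATION HEADER (lean-in-tree rule).  Audit cell `pub-balaban`, sub-cell `t4`, BINDER row NE9; filed by the row OWNER lineage `b2b-balaban-t4-ne9-p1`
(gen 88; plan v8 «the K̃-floor transfer + the π-junction», the (117)-reading of the π-junction — the owner's `B9Eq3126EnergyBallTowerCLM` (gen 87) for
print's letters).  Sources READ by this lineage in the held texts: [Balaban1985Variational] pp. 285, 293–295 (`paper:balaban1985-cmp102-variational-background`,
journal page = PDF page + 276); [Balaban1985BackgroundPropagators] pp. 416, 419–421, 425–426 (`paper:balaban1985-cmp99-background-propagators`, journal page =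
PDF page + 388).

THE PRINT (verbatim).  [Balaban1985Variational] p. 295 L7–L9: *«By Theorem 3.13 of [5] the norm max{| |_(−1), |∇ |_(−2)} of the transformation can be
estimated by [(117)] if ε₄ + B₀|B| ≤ a₃»*; [Balaban1985BackgroundPropagators] p. 420: *«H B = G̃Q*(QG̃Q*)⁻¹B. (3.126) … the operator G̃ used in the above
formula has all the properties formulated in Theorems 3.3, 3.10»*; p. 426, Thm 3.13: *«If an external gauge field configuration U satisfies the regularity
conditions (3.35), (3.36) for α₀ sufficiently small, then Theorems 3.3, 3.10, 3.11 hold for the propagator 𝔊»*.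

WHY THIS FILE (cell context; DIAGNOSIS D-ne9p1-g87-1).  The (117)-isolation `B9Eq3126EnergyBallTowerCLM` (gen 87) reads the chain's letters — print's
`G₀`-slot letters — in the chart's Banach type.  The letters that satisfy print's `Q𝔊 = 0`, `RD*𝔊 = 0` ([B11] p. 294; `B9Eq3119DeltaPiTower.Q_frakGLatticeK_pi` ∕
`RDstar_frakGLatticeK_pi` modulo (3.115)) are those of print's operator (3.122).  Their LEVEL-FREE `L²` letters on the
diagonal are in the tree across the slot change (`B9Eq3153FrakGkBoundSlotDiagonal` §4 for `𝔊̃_k`; the owner's `B9Eq3126KFloorSlotDiagonal` for `H̃_{1,k}`,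
the `(QG̃Q*)⁻¹`-letter transferred variationally), modulo the θ-letter and `C_K`, both inhabited on the diagonal by ne9-leaf-02's closed files.  THIS file
inhabits them and transports the two letters to the chart type exactly as the gen-87 file does for the chain: the residual non-uniformity of the `k`-level chart AT PRINT's OPERATOR is
again ONE displayed (117) product per letter — the volume factor and `M_∇ = 2|η|⁻¹` that print removes by Thm 3.13's DECAY (not in the tree).

WHAT IS PROVED (sorry-free; no `def`, no `Prop` placeholder; no inequality of the paper asserted hypothesis-free).
* **`exists_energy_ball_pi_CLM_diagonal_closed`** — there are `α₀, C > 0` (`C` closed in `(d, a, a′, L, M_φ, M_φ′, r, C_τ, ρ_w)`) such that for every `n`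
  (`3 ≤ L^{n+1}`), `η > 0` (`ηL^{n+1} = 1`), `c₀, c₁` (`c₀(L^{n+1})^d = c₁`, `|η|^d∕c₀ ≤ ρ_w`), `m`, ANY level maps `lev₀, lev_B, lev₁`, every background
  `U` of E162's data which is unitary, `U(b) ∈ U1`, in the windows `‖U(b) − 1‖ ≤ αη`, `‖U(∂p) − 1‖ ≤ αη²`, `‖Ū^j(b) − 1‖ ≤ ε_j ≤ αr^j` (`0 ≤ α ≤ α₀`), with
  averaged bonds `Ū^j(b) ∈ U1`, and ANY witnesses `hpos′` (site operator), `hpos₁` (positivity of `laplaceAkPi … U a′ hpos′ …`), `hQU`: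
  `‖H1LatticeCLM φ hpos₁ hQU lev₁ (∇_U)‖ ≤ C·V_H` and `‖frakGLatticeCLM φ hpos₁ hQU lev₁ (∇_U)‖ ≤ C·V_G` with the two (117) products
  `V_H = max(w̄₀, w̄₁·2|η|⁻¹)·(M_φ√(c₁#β_m)M_φ′∕√c₀)·w̲_B⁻¹`, `V_G = max(w̄₀, w̄₁·2|η|⁻¹)·(M_φ√(c₀#β_k)M_φ′∕√c₀)·w̲₀⁻¹` displayed verbatim.  MECHANISM: the level-free `L²` letters of
  print's operator — `B9Eq3153FrakGkBoundSlotDiagonal.exists_norm_frakGk_slot_le_diagonal_closed` (`‖𝔊̃_k(U)x‖ ≤ (12∕γ₁)‖x‖`) and the owner's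
  `B9Eq3126KFloorSlotDiagonal.exists_KFloor_slot_diagonal` (`‖H̃_{1,k}(U)b‖ ≤ √(3C_K∕γ₁)‖b‖`) at print's slot `Δ₁ := π_k†Δ^ηπ_k` with the θ-letter
  `θ = θ̄α` (ne9-leaf-02's `exists_form_defect_piOfUk_diagonal_closed`), `C_K` (ne9-leaf-02's `exists_norm_KinvLatticeK_H1LatticeK_le_diagonal_closed`), the
  symmetry from unitarity + the trace letters (`laplaceAkPi_isSymmetric`) and the chain's positivity at `U` (`exists_energy_letters_diagonal_closed`) ALL
  INHABITED — transported by `B11Eq117TransformationNorm.norm_H1CLM_le` ∕ `norm_frakG_fun_le` with `‖∇_U‖ ≤ 2|η|⁻¹` (`norm_nabla115_le`), exactly as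
  `B9Eq3126EnergyBallTowerCLM` does for the chain's letters.
HONEST SCOPE.  [folklore] composition by name; the (117) factors ARE load-bearing (finite-lattice numbers growing with the level and the volume) — NOT print's
lattice-uniform `B₀` (Thm 3.13's decay), only its `L²` half made uniform and the other half displayed; the small-field WINDOWS, E162's data, unitarity + the
trace letters, `ρ_w`, the averaged-bond membership and the witnesses stay HYPOTHESES.  NOT summit progress (cell pub-balaban: NE9 NOT PRINTED ∕ NOT PROVED;
«NE9 ⇐ the named binders»; row WALLED ON A MODEL (O-NE9-1; #5 UNRULED); spine PROVED 0∕9; rung (B)+1 finite T⁴ — NOT infinite volume, NOT mass gap, NOT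
BetaPertH, NOT Clay).  HONEST DEPENDENCY (cell line): continuum YM on T⁴ ⇐ BetaPertH ∧ nine spine estimates (0/9 proved); BetaPertH ⇐ (D1) ∧ (D4) ∧ CAP+tail;
G-an2-4 gates asym, D1 and NE2/3/4.  NEW file; nothing modified.  Net new unproved facts: 0.
-/

noncomputable section

open scoped InnerProductSpace ComplexConjugate BigOperators

namespace Literature.MathematicalPhysics.QuantumFieldTheory.Balaban1983to89.B9Eq3126EnergyBallTowerPiCLM

open B4Sect5Torus (TSite)
open B9SectCLatticeCarrier (Bond)
open B11Eq103H1Complex (SiteL2K BondL2K covDerivL2K covDivL2K laplaceALatticeK G1LatticeK H1LatticeK frakGLatticeK KinvLatticeK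
  H1LatticeCLM frakGLatticeCLM)
open B11Eq115Space (NegSize Space115 levWeight)
open B11Eq111FrakG (nabla115)
open B11Eq117TransformationNorm (norm_H1CLM_le norm_frakG_fun_le norm_nabla115_le)
open B9Eq310HessianOperator (adTransportW hessOp)
open B9Eq310DeltaPrime (plaqHolU)
open B9Eq315QTorus (perCfg cornerSite)
open B9Eq315QTower (towerP UlevOf)
open B9Eq315QTowerFlat (perCfg_UlevOf_one_mem_U1 norm_Wcx_UlevOf_one_sub_one_le)
open B9Eq326OperatorTower (laplaceAk QkW RofUk)
open B9Eq324DeltaPrimeATower (laplacePrimeAk GpOfUk)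
open B9Eq3119DeltaPiTower (piOfUk laplaceAkPi)
open B9Eq310HessianOperator (covCurlL2K)
open B7Prop1Explicit (U1 Wcx boxVec)
open B9Eq310HessianHermitian (adTransportW_adjoint)
open B9Eq3119DeltaPiTower (laplaceAkPi_isSymmetric)
open B9Eq3153FrakGkBoundDiagonal (exists_energy_letters_diagonal_closed)
open B9Eq3153FrakGkBoundSlotDiagonal (exists_norm_frakGk_slot_le_diagonal_closed)
open B9Eq3126H1BoundTowerVariational (exists_norm_KinvLatticeK_H1LatticeK_le_diagonal_closed)
open B9Eq3126KFloorSlotDiagonal (exists_KFloor_slot_diagonal)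
open B9Eq3120DeltaPiPrimeFormDiagonalClosed (exists_form_defect_piOfUk_diagonal_closed)

variable {d : ℕ} (hd : 1 ≤ d) (L : ℕ) [NeZero L] (hL : 1 ≤ L)
  {𝔸 : Type*} [NormedRing 𝔸] [NormedAlgebra ℂ 𝔸] [CompleteSpace 𝔸] [NormOneClass 𝔸] [StarRing 𝔸] [NormedStarGroup 𝔸] [StarModule ℂ 𝔸]
  [FiniteDimensional ℂ 𝔸]
  {W : Type*} [NormedAddCommGroup W] [InnerProductSpace ℂ W] [FiniteDimensional ℂ W] (φ : W ≃ₗ[ℂ] 𝔸)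
  {Mφ Mφ' : ℝ} (hMφ : 0 ≤ Mφ) (hMφ' : 0 ≤ Mφ') (hφ : ∀ w, ‖φ w‖ ≤ Mφ * ‖w‖) (hφ' : ∀ X, ‖φ.symm X‖ ≤ Mφ' * ‖X‖)
  {a : ℝ} (ha : 0 < a) {a' : ℝ} (ha' : 0 < a') {r : ℝ} (hr0 : 0 ≤ r) (hr1 : r < 1)
  (τ : 𝔸 →ₗ[ℂ] ℂ) {Cτ : ℝ} (hτ : ∀ X, ‖τ X‖ ≤ Cτ * ‖X‖) (hCτ : 0 ≤ Cτ) {ρw : ℝ} (hρw : 0 ≤ ρw)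
  (hτ₁ : ∀ X : 𝔸, τ (star X) = conj (τ X)) (hτ₂ : ∀ X Y : 𝔸, τ (X * Y) = τ (Y * X))
  (hφτ : ∀ X Y : 𝔸, ⟪φ.symm X, φ.symm Y⟫_ℂ = τ (star X * Y))

include hd hMφ hMφ' hφ hφ' ha ha' hr0 hr1 hτ hCτ hρw hτ₁ hτ₂ hφτ

-- deep definitional unfolding `laplaceAkPi` ↦ `laplaceALatticeK … (π†Δπ) …`, `frakGLatticeK` ↦ `frakGLin` (as in `B9Eq3126EnergyBallTowerCLM`)
set_option maxRecDepth 8192 in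
set_option maxHeartbeats 800000 in
/-- **THE (117)-ISOLATION FOR PRINT's `k`-LEVEL CHART LETTERS ON THE DIAGONAL**: `∃ α₀ C > 0` (`C` closed in `(d, a, a′, L, M_φ, M_φ′, r, C_τ, ρ_w)`) before
every lattice ∕ height ∕ weight ∕ volume ∕ level-map ∕ background binder; then for unitary `U` in the three windows, averaged bonds in `U1`, and ANY witnesses
`hpos′ hpos₁ hQU`: `‖H1LatticeCLM φ hpos₁ hQU lev₁ (∇_U)‖ ≤ C·max(w̄₀, w̄₁·2|η|⁻¹)·(M_φ√(c₁#β_m)M_φ′∕√c₀)·w̲_B⁻¹` and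
`‖frakGLatticeCLM φ hpos₁ hQU lev₁ (∇_U)‖ ≤ C·max(w̄₀, w̄₁·2|η|⁻¹)·(M_φ√(c₀#β_k)M_φ′∕√c₀)·w̲₀⁻¹` — print's `H̃_{1,k}(U)`, `𝔊̃_k(U)` of (3.126)∕(3.153) on
`G̃` of (3.122), their `L²` letters level-free (the π-junction), (117)'s finite-lattice factor DISPLAYED as the one remaining product.  NOT print's
lattice-uniform `B₀` (Thm 3.13's decay).
[cite: Balaban1985Variational, (103) p.293, (110)–(111) p.294, (115) p.294, (117) p.295; Balaban1985BackgroundPropagators, (3.122) p.420, (3.126) p.420, (3.153) p.426, Thm 3.13 p.426] -/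
theorem exists_energy_ball_pi_CLM_diagonal_closed [Fact (0 < (L : ℝ))] :
    ∃ α₀ C : ℝ, 0 < α₀ ∧ 0 < C ∧ ∀ (n : ℕ) (η : ℝ) [Fact (0 < η)], η * (L : ℝ) ^ (n + 1) = 1 → 3 ≤ L ^ (n + 1) →
      ∀ (c₀ c₁ : ℝ) [Fact (0 < c₀)] [Fact (0 < c₁)], c₀ * ((L : ℝ) ^ (n + 1)) ^ d = c₁ → |η| ^ d / c₀ ≤ ρw →
      ∀ (m : Fin d → ℕ) [∀ i, NeZero (m i)] (lev₀ : Bond d (towerP L m (n + 1)) → ℕ) (levB : Bond d m → ℕ)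
        (lev₁ : Bond d (towerP L m (n + 1)) × Fin d → ℕ)
        (U : Bond d (towerP L m (n + 1)) → 𝔸ˣ) (αU : ℕ → ℝ) (hα1 : ∀ j, αU j ≤ 1 / 64)
        (hU1 : ∀ (j : ℕ) (x : B7Prop1Explicit.Site d) (κ : Fin d), perCfg (towerP L m (j + 1)) (UlevOf L m (n + 1) U j) x κ ∈ U1 𝔸)
        (hreg : ∀ (j : ℕ) (y : TSite d (towerP L m j)) (κ : Fin d) (r : Fin d → Fin L),
          ‖((Wcx L (perCfg (towerP L m (j + 1)) (UlevOf L m (n + 1) U j)) (cornerSite L y) κ (boxVec L r) : 𝔸ˣ) : 𝔸) - 1‖ ≤ αU j)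
        (εU : ℕ → ℝ), (∀ j, 0 ≤ εU j) → (∀ (j : ℕ) (b : Bond d (towerP L m (j + 1))), ‖(UlevOf L m (n + 1) U j b : 𝔸) - 1‖ ≤ εU j) →
      ∀ {α : ℝ}, 0 ≤ α → α ≤ α₀ →
        (∀ b, star (U b : 𝔸) = (((U b)⁻¹ : 𝔸ˣ) : 𝔸)) →
        (∀ b, U b ∈ U1 𝔸) → (∀ b, ‖(U b : 𝔸) - 1‖ ≤ α * η) →
        (∀ p : B9SectCLatticeCarrier.Plaq d (towerP L m (n + 1)), ‖(plaqHolU U p : 𝔸) - 1‖ ≤ α * η ^ 2) →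
        (∀ j < n + 1, εU j ≤ α * r ^ j) →
        (∀ (j : ℕ) (b : Bond d (towerP L m (j + 1))), UlevOf L m (n + 1) U j b ∈ U1 𝔸) →
        ∀ (hpos' : ∀ x : SiteL2K ℂ d (towerP L m (n + 1)) c₀ W, x ≠ 0 → 0 < RCLike.re ⟪x, laplacePrimeAk L m n φ η U a' (c₁ := c₁) x⟫_ℂ)
          (hpos₁ : ∀ x : BondL2K ℂ d (towerP L m (n + 1)) c₀ W, x ≠ 0 →
            0 < RCLike.re ⟪x, laplaceAkPi L m n φ τ η U a' hpos' hL αU hα1 hU1 hreg (c₁ := c₁) a x⟫_ℂ)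
          (hQU : Function.Surjective (QkW L m n φ U hL αU hα1 hU1 hreg (c₀ := c₀) (c₁ := c₁))),
        ‖H1LatticeCLM (L := (L : ℝ)) (η := η) (lev₀ := lev₀) (levB := levB) φ hpos₁ hQU lev₁ (nabla115 η U)‖ ≤
            C * (max (B11Eq115Space.NegSup.wSup (levWeight (L : ℝ) η lev₀ 1) : ℝ)
                (B11Eq115Space.NegSup.wSup (levWeight (L : ℝ) η lev₁ 2) * (2 * ‖((η : ℂ))⁻¹‖)) *
              (Mφ * Real.sqrt (c₁ * Fintype.card (Bond d m)) * Mφ' / Real.sqrt c₀) *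
              B11Eq115Space.NegSup.wInvSup (levWeight (L : ℝ) η levB 0)) ∧
        ‖frakGLatticeCLM (L := (L : ℝ)) (η := η) (lev₀ := lev₀) φ hpos₁ hQU lev₁ (nabla115 η U)‖ ≤
            C * (max (B11Eq115Space.NegSup.wSup (levWeight (L : ℝ) η lev₀ 1) : ℝ)
                (B11Eq115Space.NegSup.wSup (levWeight (L : ℝ) η lev₁ 2) * (2 * ‖((η : ℂ))⁻¹‖)) *
              (Mφ * Real.sqrt (c₀ * Fintype.card (Bond d (towerP L m (n + 1)))) * Mφ' / Real.sqrt c₀) *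
              B11Eq115Space.NegSup.wInvSup (levWeight (L : ℝ) η lev₀ 3)) := by
  -- the suppliers, `∃`-first, BY NAME (level-free constants)
  obtain ⟨αθ, θb, hαθ, hθb, HΘ⟩ := exists_form_defect_piOfUk_diagonal_closed (d := d) L φ hMφ hMφ' hφ hφ' ha' hr0 hr1 τ hτ hCτ hρw
  obtain ⟨α84, γ84, C84, hα84, hγ84, hC84, H84⟩ := exists_norm_frakGk_slot_le_diagonal_closed (d := d) L hL φ hMφ hMφ' hφ hφ' ha hr0 hr1 τ hτ hCτ hρw
  obtain ⟨αE, γE, hαE, hγE, HE⟩ := exists_energy_letters_diagonal_closed (d := d) L hL φ hMφ hMφ' hφ hφ' ha hr0 hr1 τ hτ hCτ hρw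
  obtain ⟨αK, CK, CH, hαK, hCK, hCH, HK⟩ :=
    exists_norm_KinvLatticeK_H1LatticeK_le_diagonal_closed hd L hL φ hMφ hMφ' hφ hφ' ha hr0 hr1 τ hτ hCτ hρw hτ₁ hτ₂ hφτ
  obtain ⟨α1, γ1, C1, hα1g, hγ1, hC1, H1⟩ := exists_KFloor_slot_diagonal (d := d) L hL φ hMφ hMφ' hφ hφ' ha hr0 hr1 τ hτ hCτ hρw
  -- the θ-ceiling `θ̄·α ≤ γ∕2` for the two slot files; one constant
  obtain ⟨αγ, hαγdef⟩ : ∃ αγ : ℝ, αγ = min γ84 γ1 / (2 * θb) := ⟨_, rfl⟩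
  have hγm : 0 < min γ84 γ1 := lt_min hγ84 hγ1
  have hαγ : 0 < αγ := by rw [hαγdef]; positivity
  have hsCK : 0 ≤ Real.sqrt CK := Real.sqrt_nonneg _
  obtain ⟨C, hCdef⟩ : ∃ C : ℝ, C = C84 + C1 * Real.sqrt CK := ⟨_, rfl⟩
  have hHC : C1 * Real.sqrt CK ≤ C := by rw [hCdef]; linarith [hC84.le]
  have hFC : C84 ≤ C := by rw [hCdef]; linarith [mul_nonneg hC1.le hsCK]
  have hC : 0 < C := lt_of_lt_of_le hC84 hFC
  refine ⟨min (min (min αθ α84) (min αE αK)) (min α1 αγ), C, lt_min (lt_min (lt_min hαθ hα84) (lt_min hαE hαK)) (lt_min hα1g hαγ), hC, ?_⟩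
  intro n η _ hηL hL3 c₀ c₁ _ _ hw hρ m _ lev₀ levB lev₁ U αU hα1 hU1 hreg εU hεU hUε α hα0 hαle hUst hUb hUη hpl hεg hUlev hpos' hpos₁ hQU
  have hαθ' : α ≤ αθ := hαle.trans ((min_le_left _ _).trans ((min_le_left _ _).trans (min_le_left _ _)))
  have hα84' : α ≤ α84 := hαle.trans ((min_le_left _ _).trans ((min_le_left _ _).trans (min_le_right _ _)))
  have hαE' : α ≤ αE := hαle.trans ((min_le_left _ _).trans ((min_le_right _ _).trans (min_le_left _ _)))
  have hαK' : α ≤ αK := hαle.trans ((min_le_left _ _).trans ((min_le_right _ _).trans (min_le_right _ _)))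
  have hα1' : α ≤ α1 := hαle.trans ((min_le_right _ _).trans (min_le_left _ _))
  have hαγ' : α ≤ αγ := hαle.trans ((min_le_right _ _).trans (min_le_right _ _))
  -- `hRS` and the symmetry of print's operator from unitarity + the trace letters
  have hRS : ∀ (b : Bond d (towerP L m (n + 1))) (v u : W), ⟪adTransportW φ U b v, u⟫_ℂ = ⟪v, adTransportW φ (fun b => (U b)⁻¹) b u⟫_ℂ :=
    adTransportW_adjoint φ τ hτ₂ hUst hφτ
  have hsymm₁ := laplaceAkPi_isSymmetric L m n φ τ η U a' hpos' hL αU hα1 hU1 hreg (c₁ := c₁) hUst hτ₁ hτ₂ hφτ a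
  -- the θ-letter of print's slot and its two half-windows
  have hθ := HΘ n η hηL c₀ c₁ hw hρ m U hRS α hα0 hαθ' hUb hUη hpl εU hεU hεg hUε hUlev hpos'
  have hθ0 : 0 ≤ θb * α := mul_nonneg hθb.le hα0
  have hθm : θb * α ≤ min γ84 γ1 / 2 := by
    have h1 : θb * α ≤ θb * αγ := mul_le_mul_of_nonneg_left hαγ' hθb.le
    have h2 : θb * αγ = min γ84 γ1 / 2 := by rw [hαγdef]; field_simp
    linarith
  have hθ84 : θb * α ≤ γ84 / 2 := hθm.trans (by linarith [min_le_left γ84 γ1])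
  have hθ1 : θb * α ≤ γ1 / 2 := hθm.trans (by linarith [min_le_right γ84 γ1])
  -- the chain's positivity at `U` (for the `C_K`-letter)
  have HEx := HE n η hηL c₀ c₁ hw hρ m U αU hα1 hU1 hreg εU hεU hUε hα0 hαE' hRS hUb hUη hpl hεg
  have hposU : ∀ x : BondL2K ℂ d (towerP L m (n + 1)) c₀ W, x ≠ 0 →
      0 < RCLike.re ⟪x, laplaceAk L m n φ η U hL αU hα1 hU1 hreg τ (c₀ := c₀) (c₁ := c₁) a x⟫_ℂ := fun x hx => by
    have h := (HEx x).1
    have hx' : 0 < ‖x‖ := norm_pos_iff.2 hx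
    have h2 : 0 < γE * (‖covCurlL2K ℂ c₀ ((η : ℂ))⁻¹ (adTransportW φ (fun _ : Bond d (towerP L m (n + 1)) => (1 : 𝔸ˣ))) x‖ ^ 2 +
        ‖covDivL2K ℂ c₀ ((η : ℂ))⁻¹ (adTransportW φ fun _ : Bond d (towerP L m (n + 1)) => (1 : 𝔸ˣ)⁻¹) x‖ ^ 2 + ‖x‖ ^ 2) :=
      mul_pos hγE (add_pos_of_nonneg_of_pos (add_nonneg (sq_nonneg _) (sq_nonneg _)) (pow_pos hx' 2))
    linarith
  have hK := HK n η hηL hL3 c₀ c₁ hw hρ m U αU hα1 hU1 hreg εU hεU hUε hα0 hαK' hUst hUb hUη hpl hεg hposU hQU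
  -- the two level-free `L²` letters of print's operator, weakened to the common constant
  have hH : ∀ b : BondL2K ℂ d m c₁ W, ‖H1LatticeK hpos₁ hQU b‖ ≤ C * ‖b‖ := fun b =>
    ((H1 n η hηL c₀ c₁ hw hρ m U αU hα1 hU1 hreg εU hεU hUε hα0 hα1' hRS hUb hUη hpl hεg _ hθ0 hθ1 hθ hsymm₁ hpos₁ hposU hQU hCK.le hK.1).2 b).1.trans
      (mul_le_mul_of_nonneg_right hHC (norm_nonneg _))
  have hG : ∀ x : BondL2K ℂ d (towerP L m (n + 1)) c₀ W,
      ‖B11Eq111FrakG.frakGLin (G1LatticeK hpos₁) (QkW L m n φ U hL αU hα1 hU1 hreg (c₀ := c₀) (c₁ := c₁))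
        (LinearMap.adjoint (QkW L m n φ U hL αU hα1 hU1 hreg (c₀ := c₀) (c₁ := c₁))) (KinvLatticeK hpos₁ hQU)
        (covDerivL2K ℂ c₀ ((η : ℂ))⁻¹ (adTransportW φ U)) (RofUk L m n φ η U)
        (covDivL2K ℂ c₀ ((η : ℂ))⁻¹ (adTransportW φ fun b => (U b)⁻¹)) x‖ ≤ C * ‖x‖ := fun x =>
    ((H84 n η hηL c₀ c₁ hw hρ m U αU hα1 hU1 hreg εU hεU hUε hα0 hα84' hRS hUb hUη hpl hεg _ hθ0 hθ84 hθ hsymm₁ hpos₁ hQU x).1).trans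
      (mul_le_mul_of_nonneg_right hFC (norm_nonneg _))
  -- `‖∇_U‖ ≤ 2|η|⁻¹` from the unit-boundedness of the bond variables
  have hUb' : ∀ b : Bond d (towerP L m (n + 1)), ‖(U b : 𝔸)‖ ≤ 1 ∧ ‖(((U b)⁻¹ : 𝔸ˣ) : 𝔸)‖ ≤ 1 := fun b =>
    B7Prop1Explicit.mem_U1.1 (hUb b)
  have hD : ∀ g : Bond d (towerP L m (n + 1)) → 𝔸, ‖nabla115 η U g‖ ≤ (2 * ‖((η : ℂ))⁻¹‖) * ‖g‖ := fun g =>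
    norm_nabla115_le η U hUb' g
  refine ⟨?_, ?_⟩
  · have h := norm_H1CLM_le (L := (L : ℝ)) (η := η) (lev₀ := lev₀) (levB := levB) φ hMφ hφ hMφ' hφ' lev₁ (nabla115 η U)
      (H1LatticeK hpos₁ hQU) hC.le hH hD
    exact le_of_le_of_eq h (by ring)
  · have h := norm_frakG_fun_le (L := (L : ℝ)) (η := η) (lev₀ := lev₀) φ hMφ hφ hMφ' hφ' lev₁ (nabla115 η U) (G1LatticeK hpos₁)
      (QkW L m n φ U hL αU hα1 hU1 hreg (c₀ := c₀) (c₁ := c₁)) (KinvLatticeK hpos₁ hQU) (covDerivL2K ℂ c₀ ((η : ℂ))⁻¹ (adTransportW φ U))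
      (RofUk L m n φ η U) (covDivL2K ℂ c₀ ((η : ℂ))⁻¹ (adTransportW φ fun b => (U b)⁻¹)) hC.le hG hD
    exact le_of_le_of_eq h (by ring)

end Literature.MathematicalPhysics.QuantumFieldTheory.Balaban1983to89.B9Eq3126EnergyBallTowerPiCLM

end
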